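/-
Copyright: the b2b-balaban T⁴-continuum CRUX team, row NE7b OWNER lineage `t4-ne7b-p1` (gen 128). Project licence.
-/
import Literature.Probability.Distributions.GaussianQuadraticTilt
import Literature.Analysis.Matrix.DetOneSubTraceBound
import Literature.Analysis.Matrix.RegulatorSubcriticality

/-!
# THE GAUSSIAN COST OF A QUADRATIC REGULATOR IS EXPONENTIAL IN ITS TRACE: for a centred Gaussian vector with positive semidefinite
# covariance `Γ ≤ γ_op·1` (singular `Γ` allowed) and a positive semidefinite regulator `M ≤ κ·1` with `κγ_op ≤ θ < 1`,
# `E_{N(0,Γ)} e^{½ xᵀMx} ≤ (1 − θ)^{−tr(MΓ)∕(2θ)}`; for the diagonal regulator `κ·1_Y` of a site set `Y` with `Γ(y,y) ≤ γ` on `Y` this is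
# `E e^{½κΣ_{y∈Y} x_y²} ≤ A^{#Y}`, `A = (1−θ)^{−κγ∕(2θ)}` — MULTIPLICATIVE in the number of sites — and large fields cost
# `P(t ≤ Σ_{y∈Y} x_y²) ≤ e^{−κt∕2}·A^{#Y}` (row NE7b, node U5c; the tree's regulator formula `E e^{½xᵀMx} = det(1 − ΓM)^{−1∕2}`
# (`GaussianQuadraticTilt`) + the determinant–trace bound `det(1 − B)^{−1∕2} ≤ (1−θ)^{−trB∕(2θ)}` (`DetOneSubTraceBound`) BY NAME; [folklore])

Cell `pub-balaban`, sub-cell `t4`, spine estimate NE7b (`T4WeightBudget.RelWeightBound`; the cell's OWN estimate — NOT PRINTED in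
[Bałaban 1983–89], NOT PROVED).  Crux-route work under `Spine/NE7b/` by the row OWNER (`t4-ne7b-p1` gen 128, file (288)) under FREEZE
(0)'s crux-prover clause, on § [NE7bP1-G127-HANDOFF] NEXT (3)(b); NOTHING of Bałaban's is named as a Lean object, valued or asserted; no
`T4Continuum/Support` leaf typed; no `def`, no notation; zero `sorry`.  Imports (BY NAME): the tree's
`Literature/Probability/Distributions/GaussianQuadraticTilt` (`integral_exp_half_quadratic_multivariateGaussian`: `∫ e^{½xᵀMx} dN(0,S) =
1∕√det(1 − SM)` for `S ⪰ 0`, `M = Mᵀ`, `1 − √S M √S ≻ 0`; `integrable_exp_half_quadratic_shift_multivariateGaussian`),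
`Literature/Analysis/Matrix/DetOneSubTraceBound` (`rpow_trace_le_det_one_sub`: `(1−θ)^{trB∕θ} ≤ det(1 − B)` for `0 ⪯ B ⪯ θ·1`, `0 < θ < 1`
— Adams–Buchholz–Kotecký–Müller's «standard estimate for the determinant»), `Literature/Analysis/Matrix/RegulatorSubcriticality`
(`posSemidef_cfcSqrt`, `conjTranspose_cfcSqrt`, `det_one_sub_mul_eq_det_one_sub_sqrt_mul_sqrt`), `GaussianToolkit.transpose_sqrt`; Mathlib's
`Matrix.PosSemidef.conjTranspose_mul_mul_same ∕ smul ∕ add ∕ diagonal`, `CFC.sqrt_mul_sqrt_self`, `Matrix.trace_mul_comm`,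
`MeasureTheory.mul_meas_ge_le_integral_of_nonneg`.

WHY (located).  (287) reduced the polymer gas of the road's fluctuation step to the ACTIVITY bound `‖E ∏_{p∈K} g_p‖ ≤ ε^{#K}`; the road's
factors obey a REGULATED bound `‖g_p(ζ)‖ ≤ ε·e^{½κΣ_{x∈p}ζ_x²}` ((290)), so `‖E∏_{p∈K} g_p‖ ≤ ε^{#K}·E e^{½κΣ_{x∈∪K}ζ_x²}` and what is
needed is a Gaussian bound for the quadratic regulator that is MULTIPLICATIVE in the number of cells — which the union-bound tail of (285)
is not.  This file supplies it from the tree's exact regulator formula and determinant–trace estimate: the cost of regulating the sites of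
`Y` is `A^{#Y}` with `A = (1−θ)^{−κγ∕(2θ)}` depending only on `κ·γ` (regulator strength × variance scale) and the subcriticality margin `θ`.

WHAT IS PROVED ([folklore]):
* §1 matrix algebra of the conjugated regulator `B = √Γ M √Γ`: `sqrt_conj_posSemidef` (`B ⪰ 0`), `sqrt_smul_one_sqrt` (`√Γ(κ·1)√Γ = κΓ`),
  `smul_one_sub_sqrt_conj_posSemidef` (`Γ ⪯ γ_op·1`, `M ⪯ κ·1`, `κ ≥ 0` ⟹ `B ⪯ κγ_op·1`), `trace_sqrt_conj` (`tr B = tr(MΓ)`),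
  `one_sub_posDef_of_margin` (`B ⪯ θ·1`, `θ < 1` ⟹ `1 − B ≻ 0`), `transpose_eq_of_posSemidef`;
* §2 **`integral_exp_half_quadratic_le`** (`E_{N(0,Γ)} e^{½xᵀMx} ≤ (1−θ)^{−tr(MΓ)∕(2θ)}` under `Γ ⪯ γ_op·1`, `0 ⪯ M ⪯ κ·1`, `κγ_op ≤ θ`,
  `0 < θ < 1`), `integrable_exp_half_quadratic`;
* §3 diagonal regulators: `diagonal_form_eq` (`xᵀ(diag w)x = Σ w_i x_i²`), `trace_diagonal_mul` (`tr(diag w·Γ) = Σ w_iΓ_ii`),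
  **`integral_exp_half_weighted_sq_le`** (`0 ≤ w ≤ κ`, `0 ≤ κ` ⟹ `E e^{½Σw_ix_i²} ≤ (1−θ)^{−Σw_iΓ_ii∕(2θ)}`), `integrable_exp_half_weighted_sq`, THE END
  **`integral_exp_half_sq_on_le`** (`E e^{½κΣ_{y∈Y}x_y²} ≤ ((1−θ)^{−κγ∕(2θ)})^{#Y}` when `Γ(y,y) ≤ γ` on `Y`), `integrable_exp_half_sq_on`;
* §4 **`measureReal_sum_sq_ge_le`** (exponential Chebyshev: `P(t ≤ Σ_{y∈Y}x_y²) ≤ e^{−κt∕2}·((1−θ)^{−κγ∕(2θ)})^{#Y}`); §5 toy.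

HONEST (what this is NOT).  The tree's regulator formula and determinant bound read with a margin; no cells, no polymer gas (that is
(289)), no estimate of the road's factors ((290)); scalar skeleton ((A3), NC-NE7b-α UNRULED); nothing of Bałaban's asserted.  BY-NAME EFFECT
ON THE WALL: NONE.  NE7b NOT PRINTED ∕ NOT PROVED; spine PROVED 0∕9; rung (B)+1 — the programme's measures remain FINITE-torus statements; NOT
the mass gap, NOT Clay.  HONEST DEPENDENCY: continuum YM on T⁴ ⇐ BetaPertH ∧ nine spine estimates (0∕9 proved); BetaPertH ⇐ (D1) ∧ (D4) ∧
CAP+tail; G-an2-4 gates asym, D1 and NE2∕3∕4.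
-/

set_option autoImplicit false

noncomputable section

namespace Summit.QuantumFields.BalabanUV.T4Continuum.NE7b.SupGaussianRegulator

open MeasureTheory ProbabilityTheory Matrix Real WithLp
open scoped MatrixOrder BigOperators
open Literature.Probability.Distributions (integral_exp_half_quadratic_multivariateGaussian
  integrable_exp_half_quadratic_shift_multivariateGaussian)
open Literature.Analysis.Matrix (rpow_trace_le_det_one_sub conjTranspose_cfcSqrt det_one_sub_mul_eq_det_one_sub_sqrt_mul_sqrt)

variable {ι : Type*} [Fintype ι] [DecidableEq ι]

/-! ## §1. The conjugated regulator `B = √Γ M √Γ` -/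

/-- `√Γ M √Γ ⪰ 0` for `M ⪰ 0`. [folklore] -/
theorem sqrt_conj_posSemidef (Γ : Matrix ι ι ℝ) {M : Matrix ι ι ℝ} (hM : M.PosSemidef) :
    (CFC.sqrt Γ * M * CFC.sqrt Γ).PosSemidef := by
  have h := hM.conjTranspose_mul_mul_same (CFC.sqrt Γ)
  rwa [conjTranspose_cfcSqrt] at h

/-- `√Γ (κ·1) √Γ = κΓ` for `Γ ⪰ 0`. [folklore] -/
theorem sqrt_smul_one_sqrt {Γ : Matrix ι ι ℝ} (hΓ : Γ.PosSemidef) (κ : ℝ) :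
    CFC.sqrt Γ * (κ • (1 : Matrix ι ι ℝ)) * CFC.sqrt Γ = κ • Γ := by
  rw [Matrix.mul_smul, Matrix.mul_one, Matrix.smul_mul, CFC.sqrt_mul_sqrt_self Γ hΓ.nonneg]

/-- **THE MARGIN**: `0 ⪯ Γ ⪯ γ_op·1`, `M ⪯ κ·1`, `κ ≥ 0` ⟹ `√Γ M √Γ ⪯ κγ_op·1`. [folklore] -/
theorem smul_one_sub_sqrt_conj_posSemidef {Γ M : Matrix ι ι ℝ} {γop κ : ℝ} (hΓ : Γ.PosSemidef)
    (hΓop : (γop • (1 : Matrix ι ι ℝ) - Γ).PosSemidef) (hMκ : (κ • (1 : Matrix ι ι ℝ) - M).PosSemidef) (hκ : 0 ≤ κ) :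
    ((κ * γop) • (1 : Matrix ι ι ℝ) - CFC.sqrt Γ * M * CFC.sqrt Γ).PosSemidef := by
  have h1 : (CFC.sqrt Γ * (κ • (1 : Matrix ι ι ℝ) - M) * CFC.sqrt Γ).PosSemidef := sqrt_conj_posSemidef Γ hMκ
  have h2 : (κ • (γop • (1 : Matrix ι ι ℝ) - Γ)).PosSemidef := hΓop.smul hκ
  have h12 := h1.add h2
  rw [Matrix.mul_sub, Matrix.sub_mul, sqrt_smul_one_sqrt hΓ, smul_sub, smul_smul] at h12
  convert h12 using 1
  abel

/-- `tr(√Γ M √Γ) = tr(MΓ)` for `Γ ⪰ 0`. [folklore] -/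
theorem trace_sqrt_conj {Γ : Matrix ι ι ℝ} (hΓ : Γ.PosSemidef) (M : Matrix ι ι ℝ) :
    (CFC.sqrt Γ * M * CFC.sqrt Γ).trace = (M * Γ).trace := by
  rw [Matrix.mul_assoc, Matrix.trace_mul_comm, Matrix.mul_assoc, CFC.sqrt_mul_sqrt_self Γ hΓ.nonneg]

omit [Fintype ι] in
/-- **SUBCRITICALITY FROM THE MARGIN**: `B ⪯ θ·1` with `θ < 1` ⟹ `1 − B ≻ 0`. [folklore] -/
theorem one_sub_posDef_of_margin {B : Matrix ι ι ℝ} {θ : ℝ} (hθ1 : θ < 1) (h : (θ • (1 : Matrix ι ι ℝ) - B).PosSemidef) :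
    (1 - B).PosDef := by
  have h1 : ((1 - θ) • (1 : Matrix ι ι ℝ)).PosDef := Matrix.PosDef.one.smul (by linarith)
  have h2 := h1.add_posSemidef h
  rw [sub_smul, one_smul] at h2
  convert h2 using 1
  abel

omit [Fintype ι] [DecidableEq ι] in
/-- `Mᵀ = M` for a real positive semidefinite matrix. [folklore] -/
theorem transpose_eq_of_posSemidef {M : Matrix ι ι ℝ} (hM : M.PosSemidef) : Mᵀ = M := by
  have h := hM.isHermitian
  rwa [Matrix.IsHermitian, Matrix.conjTranspose_eq_transpose_of_trivial] at h

/-! ## §2. The regulator expectation -/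

/-- **THE GAUSSIAN COST OF A QUADRATIC REGULATOR.**  `Γ ⪰ 0` with `Γ ⪯ γ_op·1`, `0 ⪯ M ⪯ κ·1`, `0 ≤ κ`, `0 < θ < 1`, `κγ_op ≤ θ` ⟹
`∫ e^{½ xᵀMx} dN(0,Γ) ≤ (1 − θ)^{−tr(MΓ)∕(2θ)}` (the exact value `det(1 − ΓM)^{−1∕2}` and `det(1 − √ΓM√Γ) ≥ (1−θ)^{tr∕θ}`). [folklore] -/
theorem integral_exp_half_quadratic_le {Γ M : Matrix ι ι ℝ} {γop κ θ : ℝ} (hΓ : Γ.PosSemidef)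
    (hΓop : (γop • (1 : Matrix ι ι ℝ) - Γ).PosSemidef) (hM : M.PosSemidef) (hMκ : (κ • (1 : Matrix ι ι ℝ) - M).PosSemidef)
    (hκ : 0 ≤ κ) (hθ0 : 0 < θ) (hθ1 : θ < 1) (hκθ : κ * γop ≤ θ) :
    ∫ x, exp ((ofLp x ⬝ᵥ M *ᵥ ofLp x) / 2) ∂(multivariateGaussian 0 Γ) ≤ (1 - θ) ^ (-((M * Γ).trace / (2 * θ))) := by
  set B := CFC.sqrt Γ * M * CFC.sqrt Γ with hB
  have hB0 : B.PosSemidef := sqrt_conj_posSemidef Γ hM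
  have hBθ : (θ • (1 : Matrix ι ι ℝ) - B).PosSemidef := by
    have h := smul_one_sub_sqrt_conj_posSemidef hΓ hΓop hMκ hκ
    have h' : ((θ - κ * γop) • (1 : Matrix ι ι ℝ)).PosSemidef := Matrix.PosSemidef.one.smul (by linarith)
    have h'' := h.add h'
    rw [sub_smul] at h''
    convert h'' using 1
    abel
  have hsub : (1 - CFC.sqrt Γ * M * CFC.sqrt Γ).PosDef := one_sub_posDef_of_margin hθ1 hBθ
  have h1θ : 0 < 1 - θ := by linarith
  rw [integral_exp_half_quadratic_multivariateGaussian hΓ (transpose_eq_of_posSemidef hM) hsub,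
    det_one_sub_mul_eq_det_one_sub_sqrt_mul_sqrt hΓ M, ← hB, ← trace_sqrt_conj hΓ M, ← hB]
  have hlow : (1 - θ) ^ (B.trace / θ) ≤ (1 - B).det := rpow_trace_le_det_one_sub hB0 hθ0 hθ1 hBθ
  have hpos : 0 < (1 - θ) ^ (B.trace / θ) := Real.rpow_pos_of_pos h1θ _
  calc 1 / Real.sqrt (1 - B).det ≤ 1 / Real.sqrt ((1 - θ) ^ (B.trace / θ)) :=
        one_div_le_one_div_of_le (Real.sqrt_pos.2 hpos) (Real.sqrt_le_sqrt hlow)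
    _ = (1 - θ) ^ (-(B.trace / (2 * θ))) := by
        rw [Real.sqrt_eq_rpow, ← Real.rpow_mul h1θ.le, Real.rpow_neg h1θ.le, one_div]
        congr 2
        ring

/-- Integrability of the regulator under the same hypotheses. [folklore] -/
theorem integrable_exp_half_quadratic {Γ M : Matrix ι ι ℝ} {γop κ θ : ℝ} (hΓ : Γ.PosSemidef)
    (hΓop : (γop • (1 : Matrix ι ι ℝ) - Γ).PosSemidef) (hM : M.PosSemidef) (hMκ : (κ • (1 : Matrix ι ι ℝ) - M).PosSemidef)
    (hκ : 0 ≤ κ) (hθ1 : θ < 1) (hκθ : κ * γop ≤ θ) :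
    Integrable (fun x : EuclideanSpace ℝ ι => exp ((ofLp x ⬝ᵥ M *ᵥ ofLp x) / 2)) (multivariateGaussian 0 Γ) := by
  have hBθ : (θ • (1 : Matrix ι ι ℝ) - CFC.sqrt Γ * M * CFC.sqrt Γ).PosSemidef := by
    have h := smul_one_sub_sqrt_conj_posSemidef hΓ hΓop hMκ hκ
    have h' : ((θ - κ * γop) • (1 : Matrix ι ι ℝ)).PosSemidef := Matrix.PosSemidef.one.smul (by linarith)
    have h'' := h.add h'
    rw [sub_smul] at h''
    convert h'' using 1
    abel
  have hsub : (1 - CFC.sqrt Γ * M * CFC.sqrt Γ).PosDef := one_sub_posDef_of_margin hθ1 hBθ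
  have h := integrable_exp_half_quadratic_shift_multivariateGaussian (S := Γ) (transpose_eq_of_posSemidef hM) hsub 0
  simpa using h

/-! ## §3. Diagonal regulators -/

omit [DecidableEq ι] in
/-- `v·v`-weighted: `xᵀ(diag w)x = Σ_i w_i x_i²`. [folklore] -/
theorem diagonal_form_eq [DecidableEq ι] (w : ι → ℝ) (v : ι → ℝ) : v ⬝ᵥ (diagonal w) *ᵥ v = ∑ i, w i * v i ^ 2 := by
  simp only [dotProduct, mulVec_diagonal]
  exact Finset.sum_congr rfl fun i _ => by ring

/-- `tr(diag w · Γ) = Σ_i w_i Γ(i,i)`. [folklore] -/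
theorem trace_diagonal_mul (w : ι → ℝ) (Γ : Matrix ι ι ℝ) : (diagonal w * Γ).trace = ∑ i, w i * Γ i i := by
  simp [Matrix.trace, diagonal_mul]

omit [Fintype ι] in
/-- `diag w ⪰ 0` for `w ≥ 0`, and `κ·1 − diag w = diag(κ − w) ⪰ 0` for `w ≤ κ`. [folklore] -/
theorem diagonal_bounds (w : ι → ℝ) {κ : ℝ} (hw0 : ∀ i, 0 ≤ w i) (hwκ : ∀ i, w i ≤ κ) :
    (diagonal w).PosSemidef ∧ (κ • (1 : Matrix ι ι ℝ) - diagonal w).PosSemidef := by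
  refine ⟨Matrix.PosSemidef.diagonal fun i => hw0 i, ?_⟩
  have h : κ • (1 : Matrix ι ι ℝ) - diagonal w = diagonal fun i => κ - w i := by
    ext i j
    by_cases hij : i = j
    · subst hij; simp
    · simp [hij]
  rw [h]
  exact Matrix.PosSemidef.diagonal fun i => sub_nonneg.2 (hwκ i)

/-- **WEIGHTED SQUARES**: `Γ ⪰ 0` with `Γ ⪯ γ_op·1`, weights `0 ≤ w_i ≤ κ`, `0 < θ < 1`, `κγ_op ≤ θ` ⟹
`∫ e^{½ Σ_i w_i x_i²} dN(0,Γ) ≤ (1−θ)^{−(Σ_i w_iΓ(i,i))∕(2θ)}`. [folklore] -/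
theorem integral_exp_half_weighted_sq_le {Γ : Matrix ι ι ℝ} {γop κ θ : ℝ} (hΓ : Γ.PosSemidef)
    (hΓop : (γop • (1 : Matrix ι ι ℝ) - Γ).PosSemidef) (w : ι → ℝ) (hw0 : ∀ i, 0 ≤ w i) (hwκ : ∀ i, w i ≤ κ) (hκ : 0 ≤ κ)
    (hθ0 : 0 < θ) (hθ1 : θ < 1) (hκθ : κ * γop ≤ θ) :
    ∫ x, exp ((∑ i, w i * x i ^ 2) / 2) ∂(multivariateGaussian 0 Γ) ≤ (1 - θ) ^ (-((∑ i, w i * Γ i i) / (2 * θ))) := by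
  obtain ⟨hM, hMκ⟩ := diagonal_bounds w hw0 hwκ
  have h := integral_exp_half_quadratic_le hΓ hΓop hM hMκ hκ hθ0 hθ1 hκθ
  rw [trace_diagonal_mul] at h
  refine le_trans (le_of_eq (integral_congr_ae (ae_of_all _ fun x => ?_))) h
  simp only [diagonal_form_eq]

/-- Integrability of the weighted-squares regulator. [folklore] -/
theorem integrable_exp_half_weighted_sq {Γ : Matrix ι ι ℝ} {γop κ θ : ℝ} (hΓ : Γ.PosSemidef)
    (hΓop : (γop • (1 : Matrix ι ι ℝ) - Γ).PosSemidef) (w : ι → ℝ) (hw0 : ∀ i, 0 ≤ w i) (hwκ : ∀ i, w i ≤ κ) (hκ : 0 ≤ κ)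
    (hθ1 : θ < 1) (hκθ : κ * γop ≤ θ) :
    Integrable (fun x : EuclideanSpace ℝ ι => exp ((∑ i, w i * x i ^ 2) / 2)) (multivariateGaussian 0 Γ) := by
  obtain ⟨hM, hMκ⟩ := diagonal_bounds w hw0 hwκ
  have h := integrable_exp_half_quadratic hΓ hΓop hM hMκ hκ hθ1 hκθ
  refine (integrable_congr (ae_of_all _ fun x => ?_)).1 h
  simp only [diagonal_form_eq]

/-- The indicator weight `κ·1_Y`: `Σ_i (κ·1_Y)_i a_i = κ Σ_{i∈Y} a_i`. [folklore] -/
theorem sum_indicator_weight (Y : Finset ι) (κ : ℝ) (a : ι → ℝ) :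
    ∑ i, (if i ∈ Y then κ else 0) * a i = κ * ∑ i ∈ Y, a i := by
  rw [Finset.mul_sum, ← Finset.sum_filter_add_sum_filter_not Finset.univ (fun i => i ∈ Y)]
  have h1 : ∑ i ∈ Finset.univ.filter (fun i => i ∈ Y), (if i ∈ Y then κ else 0) * a i = ∑ i ∈ Y, κ * a i := by
    have hY : Finset.univ.filter (fun i => i ∈ Y) = Y := by ext i; simp
    rw [hY]
    exact Finset.sum_congr rfl fun i hi => by rw [if_pos hi]
  have h2 : ∑ i ∈ Finset.univ.filter (fun i => ¬ i ∈ Y), (if i ∈ Y then κ else 0) * a i = 0 :=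
    Finset.sum_eq_zero fun i hi => by rw [if_neg (Finset.mem_filter.1 hi).2, zero_mul]
  rw [h1, h2, add_zero]

/-- **THE END — REGULATING THE SITES OF `Y` COSTS `A^{#Y}`.**  `Γ ⪰ 0` with `Γ ⪯ γ_op·1` and `Γ(y,y) ≤ γ` for `y ∈ Y`, `0 ≤ κ`, `0 < θ < 1`,
`κγ_op ≤ θ` ⟹ `∫ e^{½κΣ_{y∈Y} x_y²} dN(0,Γ) ≤ ((1−θ)^{−κγ∕(2θ)})^{#Y}`. [folklore] -/
theorem integral_exp_half_sq_on_le {Γ : Matrix ι ι ℝ} {γop γ κ θ : ℝ} (hΓ : Γ.PosSemidef)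
    (hΓop : (γop • (1 : Matrix ι ι ℝ) - Γ).PosSemidef) (hκ : 0 ≤ κ) (hθ0 : 0 < θ) (hθ1 : θ < 1) (hκθ : κ * γop ≤ θ)
    (Y : Finset ι) (hdiag : ∀ i ∈ Y, Γ i i ≤ γ) :
    ∫ x, exp (κ * (∑ i ∈ Y, x i ^ 2) / 2) ∂(multivariateGaussian 0 Γ) ≤ ((1 - θ) ^ (-(κ * γ / (2 * θ)))) ^ Y.card := by
  set w : ι → ℝ := fun i => if i ∈ Y then κ else 0 with hw
  have hw0 : ∀ i, 0 ≤ w i := fun i => by simp only [hw]; split_ifs <;> [exact hκ; exact le_rfl]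
  have hwκ : ∀ i, w i ≤ κ := fun i => by simp only [hw]; split_ifs <;> [exact le_rfl; exact hκ]
  have h := integral_exp_half_weighted_sq_le hΓ hΓop w hw0 hwκ hκ hθ0 hθ1 hκθ
  have hint : ∀ x : EuclideanSpace ℝ ι, (∑ i, w i * x i ^ 2) = κ * ∑ i ∈ Y, x i ^ 2 := fun x =>
    sum_indicator_weight Y κ (fun i => x i ^ 2)
  simp_rw [hint] at h
  refine h.trans ?_
  have htr : ∑ i, w i * Γ i i = κ * ∑ i ∈ Y, Γ i i := sum_indicator_weight Y κ (fun i => Γ i i)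
  rw [htr]
  have h1θ : 0 < 1 - θ := by linarith
  have h1θ' : 1 - θ ≤ 1 := by linarith
  -- monotone in the exponent (base `≤ 1`), then `(1−θ)^{−κγ#Y/(2θ)} = A^{#Y}`
  have hsum : κ * ∑ i ∈ Y, Γ i i ≤ κ * (γ * Y.card) := by
    refine mul_le_mul_of_nonneg_left ?_ hκ
    calc ∑ i ∈ Y, Γ i i ≤ ∑ _i ∈ Y, γ := Finset.sum_le_sum hdiag
      _ = γ * Y.card := by rw [Finset.sum_const, nsmul_eq_mul, mul_comm]
  calc (1 - θ) ^ (-((κ * ∑ i ∈ Y, Γ i i) / (2 * θ)))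
      ≤ (1 - θ) ^ (-(κ * (γ * Y.card) / (2 * θ))) := by
        refine Real.rpow_le_rpow_of_exponent_ge h1θ h1θ' ?_
        have : (κ * ∑ i ∈ Y, Γ i i) / (2 * θ) ≤ κ * (γ * Y.card) / (2 * θ) := div_le_div_of_nonneg_right hsum (by linarith)
        linarith
    _ = ((1 - θ) ^ (-(κ * γ / (2 * θ)))) ^ Y.card := by
        rw [← Real.rpow_natCast, ← Real.rpow_mul h1θ.le]
        congr 1
        ring

/-- Integrability of `e^{½κΣ_{y∈Y} x_y²}` under the same hypotheses. [folklore] -/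
theorem integrable_exp_half_sq_on {Γ : Matrix ι ι ℝ} {γop κ θ : ℝ} (hΓ : Γ.PosSemidef)
    (hΓop : (γop • (1 : Matrix ι ι ℝ) - Γ).PosSemidef) (hκ : 0 ≤ κ) (hθ1 : θ < 1) (hκθ : κ * γop ≤ θ) (Y : Finset ι) :
    Integrable (fun x : EuclideanSpace ℝ ι => exp (κ * (∑ i ∈ Y, x i ^ 2) / 2)) (multivariateGaussian 0 Γ) := by
  set w : ι → ℝ := fun i => if i ∈ Y then κ else 0 with hw
  have hw0 : ∀ i, 0 ≤ w i := fun i => by simp only [hw]; split_ifs <;> [exact hκ; exact le_rfl]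
  have hwκ : ∀ i, w i ≤ κ := fun i => by simp only [hw]; split_ifs <;> [exact le_rfl; exact hκ]
  have h := integrable_exp_half_weighted_sq hΓ hΓop w hw0 hwκ hκ hθ1 hκθ
  refine (integrable_congr (ae_of_all _ fun x => ?_)).1 h
  exact congrArg (fun t : ℝ => rexp (t / 2)) (sum_indicator_weight Y κ (fun i => x i ^ 2))

/-! ## §4. Exponential Chebyshev: large fields on `Y` -/

/-- **LARGE FIELDS ARE RARE, MULTIPLICATIVELY IN `#Y`**: under the hypotheses of `integral_exp_half_sq_on_le`, for every `t`,
`P_{N(0,Γ)}(t ≤ Σ_{y∈Y} x_y²) ≤ e^{−κt∕2}·((1−θ)^{−κγ∕(2θ)})^{#Y}`. [folklore] -/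
theorem measureReal_sum_sq_ge_le {Γ : Matrix ι ι ℝ} {γop γ κ θ : ℝ} (hΓ : Γ.PosSemidef)
    (hΓop : (γop • (1 : Matrix ι ι ℝ) - Γ).PosSemidef) (hκ : 0 ≤ κ) (hθ0 : 0 < θ) (hθ1 : θ < 1) (hκθ : κ * γop ≤ θ)
    (Y : Finset ι) (hdiag : ∀ i ∈ Y, Γ i i ≤ γ) (t : ℝ) :
    (multivariateGaussian 0 Γ).real {x : EuclideanSpace ℝ ι | t ≤ ∑ i ∈ Y, x i ^ 2}
      ≤ exp (-(κ * t / 2)) * ((1 - θ) ^ (-(κ * γ / (2 * θ)))) ^ Y.card := by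
  set μ := multivariateGaussian 0 Γ with hμ
  set f : EuclideanSpace ℝ ι → ℝ := fun x => exp (κ * (∑ i ∈ Y, x i ^ 2) / 2) with hf
  have hfint : Integrable f μ := integrable_exp_half_sq_on hΓ hΓop hκ hθ1 hκθ Y
  have hfnn : 0 ≤ᵐ[μ] f := ae_of_all _ fun x => (exp_pos _).le
  have hmarkov := mul_meas_ge_le_integral_of_nonneg hfnn hfint (exp (κ * t / 2))
  have hbound := integral_exp_half_sq_on_le hΓ hΓop hκ hθ0 hθ1 hκθ Y hdiag
  have hsub : {x : EuclideanSpace ℝ ι | t ≤ ∑ i ∈ Y, x i ^ 2} ⊆ {x | exp (κ * t / 2) ≤ f x} := fun x hx => by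
    simp only [Set.mem_setOf_eq, hf] at hx ⊢
    exact exp_le_exp.2 (by nlinarith [hx, hκ])
  have hmono : μ.real {x : EuclideanSpace ℝ ι | t ≤ ∑ i ∈ Y, x i ^ 2} ≤ μ.real {x | exp (κ * t / 2) ≤ f x} :=
    measureReal_mono hsub (measure_ne_top μ _)
  have hpos : 0 < exp (κ * t / 2) := exp_pos _
  calc μ.real {x : EuclideanSpace ℝ ι | t ≤ ∑ i ∈ Y, x i ^ 2}
      ≤ μ.real {x | exp (κ * t / 2) ≤ f x} := hmono
    _ ≤ (exp (κ * t / 2))⁻¹ * ∫ x, f x ∂μ := by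
        rw [le_inv_mul_iff₀ hpos]
        exact hmarkov
    _ ≤ exp (-(κ * t / 2)) * ((1 - θ) ^ (-(κ * γ / (2 * θ)))) ^ Y.card := by
        rw [Real.exp_neg]
        exact mul_le_mul_of_nonneg_left hbound (inv_nonneg.2 hpos.le)

/-! ## §5. Toy -/

/-- Toy: for the standard Gaussian on `ℝ²` (`Γ = 1 ⪯ 1·1`, diagonal `≤ 1`) and `κ = 1∕2 = θ`: `E e^{¼(x₀² + x₁²)} ≤ ((1∕2)^{−1∕2})² = 2`
(the exact value is `(1 − ½)^{−1} = 2`: the bound is sharp here). -/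
example : ∫ x, exp ((1 / 2 : ℝ) * (∑ i ∈ (Finset.univ : Finset (Fin 2)), x i ^ 2) / 2)
      ∂(multivariateGaussian 0 (1 : Matrix (Fin 2) (Fin 2) ℝ))
    ≤ ((1 - (1 / 2 : ℝ)) ^ (-((1 / 2 : ℝ) * 1 / (2 * (1 / 2))))) ^ (Finset.univ : Finset (Fin 2)).card :=
  integral_exp_half_sq_on_le (γop := 1) Matrix.PosSemidef.one (by rw [one_smul, sub_self]; exact Matrix.PosSemidef.zero)
    (by norm_num) (by norm_num) (by norm_num) (by norm_num) Finset.univ fun i _ => by rw [Matrix.one_apply_eq]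

end Summit.QuantumFields.BalabanUV.T4Continuum.NE7b.SupGaussianRegulator
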